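import Literature.MathematicalPhysics.QuantumFieldTheory.Balaban1983to89.B9Thm314Whole

/-!
# `Balaban1983to89.B9Thm314WholeSummation` — [B9] Theorem 3.14 (pp. 426–427): the two SUMMATION-WITH-FACTOR LEAVES of
# `B9Thm314Whole` (rows 22–23 of the N06 certificate) PROVED from a structural reading of «convergent in the norm»

T. Bałaban, *Propagators for lattice gauge theories in a background field*, Commun. Math. Phys. **99** (1985) 389–434
[`Balaban1985BackgroundPropagators`, "B9"].

statement-level skeleton of published theorems with citation tags; proofs where landed; nothing here is a claim about the Yang–Mills mass gap

THE PRINTED LOCI (verbatim).  p. 409 (proof of Theorem 3.7): *"This theorem follows simply from Corollary 3.6 holding for all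
G′_□, □ ∈ 𝒟, from the bound (3.89) and Lemma 2.1. The arguments are exactly the same as in proofs of Proposition 1.2 [3] and
Proposition 2.2 [4], so we will not repeat them here."*; p. 410: *"We will use the factor O(M^{−1/2}) to control the sum over random
walks ω"*; p. 416 (proof of Theorem 3.10): *"From (3.108) it follows that the expansion (3.107) is convergent in all norms appearing
in the inequalities (3.42)–(3.47)"*; p. 427 (proof of Theorem 3.14): *"Then the exponential factor in (3.108) gives the factor (3.154)
(after adjusting a definition of δ₀)."*

THE POINT.  `B9Thm314Whole` (rows 22–23, seat n06-m g0) proves the two Theorem-3.14 leaf fields of the certificate from the leaves of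
the printed proof; two of those leaves — `RWSumFactorYieldsSupL2` and `RWSumFactorYieldsHolder`, the Sect.-C SUMMATION with the
walk-independent extra factor carried through (GAPS G-B9-07, «by reference») — are displayed at the knit as HYPOTHESES of printed
shape (`…N06AtRecord11ObligationsPins.t314loc_of_leaves … hS hH`).  Their docstrings say when they are dischargeable: *"at a pin whose
`Converges U` entails that `K i`'s quantities are bounded by the sums of the terms' quantities, with the walk counting of (3.91)
(arithmetic: `B9Thm37Sum.walkSum_le`)"*.  THIS FILE kernel-checks exactly that discharge, generically:
* §1 the STRUCTURAL READING — `WalkSetsSpec` (finite sets `W n y y′` of walks of length n from y to y′), `DominatedBySums` (each of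
  the five local quantities (3.42)/(3.46)/(3.43)/(3.44)/(3.45) of `K` at (λ, y), supp λ ⊂ Δ̃(y′), is at most EVERY uniform bound of the
  partial sums Σ_{n<m}Σ_{ω∈W n y y′} of the same quantity of the walk terms — the shape of `B9Thm39Sum.kernel_bound_of_limit`, «limits
  keep bounds»), `WalkWeightsSummable` (for every rate δ > 0, constants N₀, D₀, δ′ > 0 UNIFORM IN THE MEMBER with
  Σ_{ω∈W n y y′} e^{−½δd(ω,y,y′)} ≤ N₀D₀ⁿe^{−δ′d(y,y′)} — met by the walk count «at most Dⁿ walks of n steps» (p. 410, (3.91)) together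
  with d(y, y′) ≤ d(ω, y, y′), §4, or by [4] Lemma 2.1 row sums; both fit the shape);
* §2 the ARITHMETIC of «M sufficiently large» — `rpow_threshold_half` (M ≥ (2D₀c)^{1/s} ⇒ D₀cM^{−s} ≤ ½) and the geometric series
  `partialSum_walkFactorS_le` (every partial sum of p·walkFactorS(A,c,M,s,δ,|ω|,d(ω))·F·σ over the walk sets is ≤ A·2N₀·p·e^{−δ′d}·F·σ;
  `B9.walkSum_le`), and the bridge `le_of_partialSums_le_of_tendsto` from a genuine convergence statement to the reading;
* §3 ★ `rwSumFactorYieldsSupL2_of_reading`, ★ `rwSumFactorYieldsHolder_of_reading` — the two leaves of `B9Thm314Whole` PROVED from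
  the reading, for every restriction `P` (constants M₃ = (2D₀c)^{1/s}, B₁ = 2N₀, δ₁ = δ′);
* §4 `walkWeightsSummable_of_card` (the naive walk count), `dist_le_wdist_of_laws` (d ≤ d(ω) from `B9Thm314.LocData.Laws`);
* §5 the ROW FACES: ★ `thm314LocalPrinted_of_reading` (row 23), ★ `thm314Printed_of_reading` (row 22), `thm314_pair_of_reading` —
  g0's `thm314LocalPrinted_of_leaves` / `thm314Printed_of_leaves_allNorms` / `thm314_pair_of_leaves` with `hS hH` ↦ the reading.

HONEST SCOPE.  Count-neutral kernel bookkeeping: a by-reference summation made kernel-checked MODULO a structural reading, which stays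
a HYPOTHESIS on the (unconstructed) expansion of the difference operator; the cancellation leaf `DiffExpansionAllNorms` (G-B9-08), the
geometry `LocData`/`Laws` and the M-uniform diameter bound `hr` (typed-leaf flag T314 (ii) STANDS) are untouched and remain displayed
exactly as in `B9Thm314Whole`.  Nothing of print is asserted; NOT a node discharge, NOT summit progress; one finite lattice programme;
nothing continuum, nothing about the mass gap.  Cell `pub-ymgap` (D-0062), node N06 [B9], N06-ASSIGNMENT v1 rows 22–23 (successor file of
bundle F8), seat `pub-ymgap-dag-n06-m` (g2), 2026-08-26.
-/

namespace Literature.MathematicalPhysics.QuantumFieldTheory.Balaban1983to89.B9Thm314WholeSummation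

open B9 B9Thm314 B9Thm314Whole B9FromB6ModelSignsOn

/-! ## §1 The structural reading of «convergent in the norm» -/

section Reading

variable {g : Geometry} {B : Backgrounds}

/-- **FINITE WALK SETS**: `W n y y′` consists of walks of length n starting at y and ending at y′ (the walks whose terms can be
nonzero at (Δ(y), supp λ ⊂ Δ̃(y′)); p. 409 (3.90) *"ω = (□₀, □₁, ⋯, □ₙ), □ᵢ ∈ 𝒟, □ᵢ ∩ □ᵢ₊₁ ≠ ∅"*).  Only the three membership
laws are needed. [cite: Balaban1985BackgroundPropagators, Thm 3.7 (3.90) p.409 + (3.107) p.415] -/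
structure WalkSetsSpec (E : RWExpansion g B) (W : ℕ → g.Site → g.Site → Finset E.Walk) : Prop where
  first : ∀ (n : ℕ) (y y' : g.Site) (ω : E.Walk), ω ∈ W n y y' → E.first ω y
  last : ∀ (n : ℕ) (y y' : g.Site) (ω : E.Walk), ω ∈ W n y y' → E.last ω y'
  wlen : ∀ (n : ℕ) (y y' : g.Site) (ω : E.Walk), ω ∈ W n y y' → E.wlen ω = n

/-- **«CONVERGENT IN ALL NORMS» READ STRUCTURALLY** (p. 409 *"The expansion is convergent in all norms appearing in the inequalities
(3.42)–(3.47)"*, p. 416 idem for (3.107)): at U, each of the five LOCAL quantities of the family `K` — the sup entries (3.42), the L²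
entries (3.46), the Hölder entries (3.43), (3.44), (3.45) — at an argument λ with supp λ ⊂ Δ̃(y′), evaluated at y (cut-offs at y), is at
most EVERY uniform bound of the partial sums, over the walk sets `W n y y′`, of the same quantity of the walk terms `termK ω`.  (What a
seminorm of a norm-convergent operator series satisfies — «limits keep bounds», `le_of_partialSums_le_of_tendsto`; the shape of
`B9Thm39Sum.kernel_bound_of_limit`.)  A hypothesis schema on the instance; nothing asserted. [cite: Balaban1985BackgroundPropagators, Thm 3.7 p.409 + Thm 3.10 proof p.416] -/
def DominatedBySums (E : RWExpansion g B) (termK : E.Walk → KernelFamily g B) (K : KernelFamily g B)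
    (W : ℕ → g.Site → g.Site → Finset E.Walk) (U : B.Cfg) : Prop :=
  (∀ (n : Fin 4) (lam : g.Loc) (y y' : g.Site), g.suppIn lam y' → ∀ b : ℝ,
      (∀ m : ℕ, ∑ k ∈ Finset.range m, ∑ ω ∈ W k y y', (termK ω).e n U lam y ≤ b) → K.e n U lam y ≤ b) ∧
  (∀ (n : Fin 6) (lam : g.Loc) (h : g.Cut) (y y' : g.Site), g.cutIn h y → g.suppIn lam y' → ∀ b : ℝ,
      (∀ m : ℕ, ∑ k ∈ Finset.range m, ∑ ω ∈ W k y y', (termK ω).l2 n U lam h ≤ b) → K.l2 n U lam h ≤ b) ∧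
  (∀ (lam : g.Loc) (β : ℝ) (ζ : g.Cut) (y y' : g.Site), g.cutIn ζ y → g.suppIn lam y' → ∀ b : ℝ,
      (∀ m : ℕ, ∑ k ∈ Finset.range m, ∑ ω ∈ W k y y', (termK ω).h1 U lam β ζ ≤ b) → K.h1 U lam β ζ ≤ b) ∧
  (∀ (lam : g.Loc) (y y' : g.Site), g.suppIn lam y' → ∀ b : ℝ,
      (∀ m : ℕ, ∑ k ∈ Finset.range m, ∑ ω ∈ W k y y', (termK ω).e4 U lam y ≤ b) → K.e4 U lam y ≤ b) ∧
  (∀ (lam : g.Loc) (β : ℝ) (ζ : g.Cut) (y y' : g.Site), g.cutIn ζ y → g.suppIn lam y' → ∀ b : ℝ,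
      (∀ m : ℕ, ∑ k ∈ Finset.range m, ∑ ω ∈ W k y y', (termK ω).h2 U lam β ζ ≤ b) → K.h2 U lam β ζ ≤ b)

variable {I : Type}

/-- **THE SUM OVER WALKS IS CONTROLLED, UNIFORMLY IN THE MEMBER** (p. 410: *"We will use the factor O(M^{−1/2}) to control the sum
over random walks ω"*; (3.91)–(3.94)): for every rate δ > 0 there are N₀, D₀, δ′ > 0, the same for all members, with
Σ_{ω ∈ W n y y′} e^{−½δd(ω,y,y′)} ≤ N₀·D₀ⁿ·e^{−δ′d(y,y′)}.  Met by «at most Dⁿ walks of n steps from a cube» with d(y,y′) ≤ d(ω,y,y′)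
(`walkWeightsSummable_of_card`, δ′ = ½δ), or by the [4] Lemma 2.1 row sums along the chain (3.93).  A hypothesis schema.
[cite: Balaban1985BackgroundPropagators, Cor. 3.8 (3.91)–(3.94) p.410] -/
def WalkWeightsSummable (geo : I → Geometry) (bg : I → Backgrounds) (E : ∀ i, RWExpansion (geo i) (bg i))
    (W : ∀ i, ℕ → (geo i).Site → (geo i).Site → Finset (E i).Walk) : Prop :=
  ∀ δ : ℝ, 0 < δ → ∃ N₀ D₀ δ' : ℝ, 0 < N₀ ∧ 0 < D₀ ∧ 0 < δ' ∧
    ∀ (i : I) (n : ℕ) (y y' : (geo i).Site),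
      ∑ ω ∈ W i n y y', Real.exp (-(δ / 2 * (E i).wdist ω y y')) ≤
        N₀ * D₀ ^ n * Real.exp (-(δ' * (geo i).dist y y'))

end Reading

/-! ## §2 Kernel-checked arithmetic: «M sufficiently large» and the geometric series with the extra factor -/

section Arithmetic

/-- **«Limits keep bounds»** — the bridge from a genuine convergence statement at an instance to `DominatedBySums`: if s_m → a,
s_m ≤ t_m (e.g. the quantity of the m-th partial-sum operator is at most the partial sum of the terms' quantities, by subadditivity)
and every t_m ≤ b, then a ≤ b. [cite: Balaban1985BackgroundPropagators, Thm 3.7 p.409 («convergent in all norms»; bookkeeping)] -/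
theorem le_of_partialSums_le_of_tendsto {a b : ℝ} {s t : ℕ → ℝ} (hconv : Filter.Tendsto s Filter.atTop (nhds a))
    (hst : ∀ m, s m ≤ t m) (ht : ∀ m, t m ≤ b) : a ≤ b :=
  le_of_tendsto' hconv fun m => (hst m).trans (ht m)

/-- **«for M sufficiently large»**, the threshold: M ≥ (2D₀c)^{1/s} (c, s, D₀ > 0) gives D₀·c·M^{−s} ≤ ½ — the ratio of the
geometric series over walk lengths. [cite: Balaban1985BackgroundPropagators, Thm 3.7 p.409 («for M sufficiently large»; bookkeeping)] -/
theorem rpow_threshold_half {c s D₀ M : ℝ} (hc : 0 < c) (hs : 0 < s) (hD₀ : 0 < D₀) (hM : (2 * D₀ * c) ^ (1 / s) ≤ M) :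
    D₀ * (c * M ^ (-s)) ≤ 1 / 2 := by
  have ha : 0 < 2 * D₀ * c := by positivity
  have hMpos : 0 < M := lt_of_lt_of_le (Real.rpow_pos_of_pos ha _) hM
  have h1 : 2 * D₀ * c ≤ M ^ s := by
    calc 2 * D₀ * c = ((2 * D₀ * c) ^ (1 / s)) ^ s := by
          rw [← Real.rpow_mul ha.le, one_div_mul_cancel hs.ne', Real.rpow_one]
      _ ≤ M ^ s := Real.rpow_le_rpow (Real.rpow_nonneg ha.le _) hM hs.le
  have h2 : M ^ (-s) ≤ (2 * D₀ * c)⁻¹ := by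
    rw [Real.rpow_neg hMpos.le]
    exact inv_anti₀ ha h1
  calc D₀ * (c * M ^ (-s)) ≤ D₀ * (c * (2 * D₀ * c)⁻¹) :=
        mul_le_mul_of_nonneg_left (mul_le_mul_of_nonneg_left h2 hc.le) hD₀.le
    _ = 1 / 2 := by field_simp

/-- **THE GEOMETRIC SERIES WITH THE EXTRA FACTOR** (p. 410 «We will use the factor O(M^{−1/2}) to control the sum over random walks»,
p. 427 «the exponential factor … gives the factor»): if every walk ω of the k-th walk set has a term quantity
q(ω) ≤ p·walkFactorS(A, c, M, s, δ, |ω|, d(ω))·F·σ = p·A(cM^{−s})^{k}e^{−½δd(ω)}·F·σ (p, A, F, σ ≥ 0), the exponential weights of the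
k-th set sum to ≤ N₀D₀^k e^{−δ′d} and D₀cM^{−s} ≤ ½, then EVERY partial sum Σ_{k<m}Σ_{ω} q(ω) ≤ A·2N₀·p·e^{−δ′d}·F·σ — uniformly in m
(`B9.walkSum_le`). [cite: Balaban1985BackgroundPropagators, Thm 3.7 / Cor. 3.8 proof pp.409–410] -/
theorem partialSum_walkFactorS_le {Wk : Type} (W : ℕ → Finset Wk) (q : Wk → ℝ) (wlen : Wk → ℕ) (wd : Wk → ℝ)
    {p A c M s δ F σ N₀ D₀ δ' dist : ℝ}
    (hq : ∀ k, ∀ ω ∈ W k, q ω ≤ p * walkFactorS A c M s δ (wlen ω) (wd ω) * F * σ)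
    (hlen : ∀ k, ∀ ω ∈ W k, wlen ω = k)
    (hcnt : ∀ k, ∑ ω ∈ W k, Real.exp (-(δ / 2 * wd ω)) ≤ N₀ * D₀ ^ k * Real.exp (-(δ' * dist)))
    (hp : 0 ≤ p) (hA : 0 ≤ A) (hF : 0 ≤ F) (hσ : 0 ≤ σ) (hN₀ : 0 ≤ N₀) (hD₀ : 0 ≤ D₀) (hcM : 0 ≤ c * M ^ (-s))
    (hx : D₀ * (c * M ^ (-s)) ≤ 1 / 2) (m : ℕ) :
    ∑ k ∈ Finset.range m, ∑ ω ∈ W k, q ω ≤ A * (2 * N₀) * p * Real.exp (-(δ' * dist)) * F * σ := by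
  have hpAFσ : 0 ≤ p * A * F * σ := mul_nonneg (mul_nonneg (mul_nonneg hp hA) hF) hσ
  -- level k: the walk factor is constant on the k-th set up to the exponential weight
  have hlev : ∀ k, ∑ ω ∈ W k, q ω ≤
      p * A * F * σ * (c * M ^ (-s)) ^ k * (N₀ * D₀ ^ k * Real.exp (-(δ' * dist))) := by
    intro k
    calc ∑ ω ∈ W k, q ω ≤ ∑ ω ∈ W k, p * A * F * σ * (c * M ^ (-s)) ^ k * Real.exp (-(δ / 2 * wd ω)) := by
          refine Finset.sum_le_sum fun ω hω => ?_
          have h := hq k ω hω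
          rw [hlen k ω hω] at h
          calc q ω ≤ _ := h
            _ = _ := by unfold walkFactorS; ring
      _ = p * A * F * σ * (c * M ^ (-s)) ^ k * ∑ ω ∈ W k, Real.exp (-(δ / 2 * wd ω)) := by rw [Finset.mul_sum]
      _ ≤ p * A * F * σ * (c * M ^ (-s)) ^ k * (N₀ * D₀ ^ k * Real.exp (-(δ' * dist))) :=
          mul_le_mul_of_nonneg_left (hcnt k) (mul_nonneg hpAFσ (pow_nonneg hcM k))
  -- sum over k < m: geometric series with ratio D₀cM^{−s} ≤ ½
  have hC : 0 ≤ p * A * F * σ * N₀ * Real.exp (-(δ' * dist)) := mul_nonneg (mul_nonneg hpAFσ hN₀) (Real.exp_nonneg _)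
  have hx0 : 0 ≤ D₀ * (c * M ^ (-s)) := mul_nonneg hD₀ hcM
  calc ∑ k ∈ Finset.range m, ∑ ω ∈ W k, q ω
      ≤ ∑ k ∈ Finset.range m, p * A * F * σ * (c * M ^ (-s)) ^ k * (N₀ * D₀ ^ k * Real.exp (-(δ' * dist))) :=
        Finset.sum_le_sum fun k _ => hlev k
    _ = ∑ k ∈ Finset.range m, 1 * (p * A * F * σ * N₀ * Real.exp (-(δ' * dist)) * (D₀ * (c * M ^ (-s))) ^ k) := by
        refine Finset.sum_congr rfl fun k _ => ?_
        rw [mul_pow]; ring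
    _ ≤ 2 * (p * A * F * σ * N₀ * Real.exp (-(δ' * dist))) :=
        walkSum_le _ _ (fun _ => 1) (fun k => p * A * F * σ * N₀ * Real.exp (-(δ' * dist)) * (D₀ * (c * M ^ (-s))) ^ k)
          hC hx0 hx (fun k => le_of_eq (one_mul _)) m
    _ = A * (2 * N₀) * p * Real.exp (-(δ' * dist)) * F * σ := by ring

end Arithmetic

/-! ## §3 The two summation-with-factor leaves of `B9Thm314Whole` PROVED from the reading -/

section Leaves

variable {I : Type} {geo : I → Geometry} {bg : I → Backgrounds} {E : ∀ i, RWExpansion (geo i) (bg i)}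
  {termK : ∀ i, (E i).Walk → KernelFamily (geo i) (bg i)} {K : ∀ i, KernelFamily (geo i) (bg i)}
  {Ps : ∀ i, (geo i).Loc → Prop}

/-- ★ **THE SUP/L² SUMMATION LEAF WITH FACTOR, PROVED FROM THE READING** (p. 416 *"From (3.108) it follows that the expansion (3.107) is
convergent in all norms"*, p. 409 *"from the bound (3.89) and Lemma 2.1"*): if every member's walk sets obey `WalkSetsSpec`, the
exponential weights are summable uniformly in the member (`WalkWeightsSummable`), and at every U the convergence predicate entails
`DominatedBySums`, then `B9Thm314Whole.RWSumFactorYieldsSupL2 geo bg E termK K P` holds for EVERY restriction `P` — with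
M₃ = (2D₀c)^{1/s}, B₁ = 2N₀, δ₁ = δ′ from the weights' constants at the rate δ.  Signs of the prefactors from `ModelSignsOn`.  Nothing of
print asserted. [cite: Balaban1985BackgroundPropagators, Thm 3.7 proof p.409 + Thm 3.10 proof p.416 + Thm 3.14 proof p.427] -/
theorem rwSumFactorYieldsSupL2_of_reading (S : ∀ i, ModelSignsOn (geo i) (Ps i))
    (W : ∀ i, ℕ → (geo i).Site → (geo i).Site → Finset (E i).Walk) (hW : ∀ i, WalkSetsSpec (E i) (W i))
    (hcnt : WalkWeightsSummable geo bg E W)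
    (hdom : ∀ (i : I) (U : (bg i).Cfg), (E i).Converges U → DominatedBySums (E i) (termK i) (K i) (W i) U)
    (P : ∀ i, (geo i).Site → Prop) : RWSumFactorYieldsSupL2 geo bg E termK K P := by
  intro c s δ hc hs hδ
  obtain ⟨N₀, D₀, δ', hN₀, hD₀, hδ', hC⟩ := hcnt δ hδ
  have h2 : 0 < 2 * D₀ * c := by positivity
  refine ⟨(2 * D₀ * c) ^ (1 / s), 2 * N₀, δ', Real.rpow_pos_of_pos h2 _, by positivity, hδ',
    fun i hMi U A F hA hF hconv hT => ?_⟩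
  have hx := rpow_threshold_half hc hs hD₀ hMi
  have hMpos : 0 < (geo i).M := lt_of_lt_of_le (Real.rpow_pos_of_pos h2 _) hMi
  have hcM : 0 ≤ c * (geo i).M ^ (-s) := mul_nonneg hc.le (Real.rpow_nonneg hMpos.le _)
  obtain ⟨hde, hdl2, -, -, -⟩ := hdom i U hconv
  refine ⟨fun n lam y y' hy hy' hs' => ?_, fun n lam h y y' hy hy' hcut hs' => ?_⟩
  · refine hde n lam y y' hs' _ fun m => ?_
    exact partialSum_walkFactorS_le (fun k => W i k y y') (fun ω => (termK i ω).e n U lam y) (E i).wlen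
      (fun ω => (E i).wdist ω y y')
      (fun k ω hω => hT.1 ω n lam y y' ((hW i).first k y y' ω hω) ((hW i).last k y y' ω hω) hy hy' hs')
      (fun k ω hω => (hW i).wlen k y y' ω hω) (fun k => hC i k y y')
      (B9FromB6.pref4_nonneg ((S i).len_nonneg y) n) hA (hF y y') ((S i).supNorm_nonneg lam) hN₀.le hD₀.le hcM hx m
  · refine hdl2 n lam h y y' hcut hs' _ fun m => ?_
    refine (partialSum_walkFactorS_le (fun k => W i k y y') (fun ω => (termK i ω).l2 n U lam h) (E i).wlen
      (fun ω => (E i).wdist ω y y')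
      (fun k ω hω => hT.2 ω n lam h y y' ((hW i).first k y y' ω hω) ((hW i).last k y y' ω hω) hy hy' hcut hs')
      (fun k ω hω => (hW i).wlen k y y' ω hω) (fun k => hC i k y y')
      (mul_nonneg (B9FromB6.pref6_nonneg ((S i).len_nonneg y) n) ((S i).cutSup_nonneg h)) hA (hF y y')
      ((S i).l2Norm_nonneg lam) hN₀.le hD₀.le hcM hx m).trans_eq ?_
    ring

/-- ★ **THE HÖLDER SUMMATION LEAF WITH FACTOR, PROVED FROM THE READING** (the same printed sentence for the norms (3.43)–(3.45); p. 410
*"Similar estimates hold for the other norms"*): under the same three structural hypotheses,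
`B9Thm314Whole.RWSumFactorYieldsHolder geo bg E termK K P` for every `P` (the β-, ε-dependent constants B₀(β), B′₀(ε), B′₀(ε,β) ride as
the walk factor's A; output functions multiplied by B₁ = 2N₀, rate δ₁ = δ′). [cite: Balaban1985BackgroundPropagators, Cor. 3.8 p.410 + Thm 3.10 proof p.416 + Thm 3.14 proof p.427] -/
theorem rwSumFactorYieldsHolder_of_reading (S : ∀ i, ModelSignsOn (geo i) (Ps i))
    (W : ∀ i, ℕ → (geo i).Site → (geo i).Site → Finset (E i).Walk) (hW : ∀ i, WalkSetsSpec (E i) (W i))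
    (hcnt : WalkWeightsSummable geo bg E W)
    (hdom : ∀ (i : I) (U : (bg i).Cfg), (E i).Converges U → DominatedBySums (E i) (termK i) (K i) (W i) U)
    (P : ∀ i, (geo i).Site → Prop) : RWSumFactorYieldsHolder geo bg E termK K P := by
  intro c s δ hc hs hδ
  obtain ⟨N₀, D₀, δ', hN₀, hD₀, hδ', hC⟩ := hcnt δ hδ
  have h2 : 0 < 2 * D₀ * c := by positivity
  refine ⟨(2 * D₀ * c) ^ (1 / s), 2 * N₀, δ', Real.rpow_pos_of_pos h2 _, by positivity, hδ',
    fun i hMi U Bβ Bε Bεβ F hBβ hBε hBεβ hF hconv hT => ?_⟩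
  have hx := rpow_threshold_half hc hs hD₀ hMi
  have hMpos : 0 < (geo i).M := lt_of_lt_of_le (Real.rpow_pos_of_pos h2 _) hMi
  have hcM : 0 ≤ c * (geo i).M ^ (-s) := mul_nonneg hc.le (Real.rpow_nonneg hMpos.le _)
  have hhs (ε : ℝ) (lam : (geo i).Loc) : 0 ≤ (geo i).holder ε lam + (geo i).supNorm lam :=
    add_nonneg ((S i).holder_nonneg ε lam) ((S i).supNorm_nonneg lam)
  obtain ⟨-, -, hdh1, hde4, hdh2⟩ := hdom i U hconv
  refine ⟨fun β lam ζ y y' hβ hβ1 hy hy' hcut hs' => ?_, fun ε lam y y' hε hε1 hy hy' hs' => ?_,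
    fun ε β lam ζ y y' hε hε1 hβ hβ1 hy hy' hcut hs' => ?_⟩
  · refine hdh1 lam β ζ y y' hcut hs' _ fun m => ?_
    refine (partialSum_walkFactorS_le (fun k => W i k y y') (fun ω => (termK i ω).h1 U lam β ζ) (E i).wlen
      (fun ω => (E i).wdist ω y y')
      (fun k ω hω => hT.1 ω β lam ζ y y' hβ hβ1 ((hW i).first k y y' ω hω) ((hW i).last k y y' ω hω) hy hy' hcut hs')
      (fun k ω hω => (hW i).wlen k y y' ω hω) (fun k => hC i k y y')
      (mul_nonneg (Real.rpow_nonneg ((S i).len_nonneg y) _) ((S i).cutH_nonneg β ζ)) (hBβ β) (hF y y')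
      ((S i).supNorm_nonneg lam) hN₀.le hD₀.le hcM hx m).trans_eq ?_
    ring
  · refine hde4 lam y y' hs' _ fun m => ?_
    have h0 : ∀ k, ∀ ω ∈ W i k y y', (termK i ω).e4 U lam y ≤
        1 * walkFactorS (Bε ε) c (geo i).M s δ ((E i).wlen ω) ((E i).wdist ω y y') * F y y' *
          ((geo i).holder ε lam + (geo i).supNorm lam) := fun k ω hω => by
      rw [one_mul]
      exact hT.2.1 ω ε lam y y' hε hε1 ((hW i).first k y y' ω hω) ((hW i).last k y y' ω hω) hy hy' hs'
    refine (partialSum_walkFactorS_le (fun k => W i k y y') (fun ω => (termK i ω).e4 U lam y) (E i).wlen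
      (fun ω => (E i).wdist ω y y') h0 (fun k ω hω => (hW i).wlen k y y' ω hω) (fun k => hC i k y y')
      zero_le_one (hBε ε) (hF y y') (hhs ε lam) hN₀.le hD₀.le hcM hx m).trans_eq ?_
    ring
  · refine hdh2 lam β ζ y y' hcut hs' _ fun m => ?_
    refine (partialSum_walkFactorS_le (fun k => W i k y y') (fun ω => (termK i ω).h2 U lam β ζ) (E i).wlen
      (fun ω => (E i).wdist ω y y')
      (fun k ω hω => hT.2.2 ω ε β lam ζ y y' hε hε1 hβ hβ1 ((hW i).first k y y' ω hω) ((hW i).last k y y' ω hω)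
        hy hy' hcut hs')
      (fun k ω hω => (hW i).wlen k y y' ω hω) (fun k => hC i k y y')
      (mul_nonneg (Real.rpow_nonneg ((S i).len_nonneg y) _) ((S i).cutH_nonneg β ζ)) (hBεβ ε β) (hF y y')
      (hhs (β + ε) lam) hN₀.le hD₀.le hcM hx m).trans_eq ?_
    ring

end Leaves

/-! ## §4 Two supplied routes to the hypotheses: the naive walk count; d(y, y′) ≤ d(ω, y, y′) from the geometry laws -/

section Routes

variable {I : Type} {geo : I → Geometry} {bg : I → Backgrounds} {E : ∀ i, RWExpansion (geo i) (bg i)}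

/-- **THE WALK COUNT ROUTE** (p. 410 / (3.91): at most Dⁿ walks of n steps from a cube, the start localisations overlapping at most
N₀-fold): if card (W i n y y′) ≤ N₀·D₀ⁿ uniformly in the member and d(y, y′) ≤ d(ω, y, y′) on the walk sets ([4] (2.54), the triangle
inequality for the distance (3.93)), then `WalkWeightsSummable` holds with δ′ = ½δ. [cite: Balaban1985BackgroundPropagators, Cor. 3.8 (3.91)–(3.93) p.410] -/
theorem walkWeightsSummable_of_card (W : ∀ i, ℕ → (geo i).Site → (geo i).Site → Finset (E i).Walk) {N₀ D₀ : ℝ}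
    (hN₀ : 0 < N₀) (hD₀ : 0 < D₀) (hcard : ∀ (i : I) (n : ℕ) (y y' : (geo i).Site), ((W i n y y').card : ℝ) ≤ N₀ * D₀ ^ n)
    (hdist : ∀ (i : I) (n : ℕ) (y y' : (geo i).Site) (ω : (E i).Walk), ω ∈ W i n y y' →
      (geo i).dist y y' ≤ (E i).wdist ω y y') :
    WalkWeightsSummable geo bg E W := by
  intro δ hδ
  refine ⟨N₀, D₀, δ / 2, hN₀, hD₀, half_pos hδ, fun i n y y' => ?_⟩
  calc ∑ ω ∈ W i n y y', Real.exp (-(δ / 2 * (E i).wdist ω y y'))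
      ≤ ∑ ω ∈ W i n y y', Real.exp (-(δ / 2 * (geo i).dist y y')) :=
        Finset.sum_le_sum fun ω hω =>
          Real.exp_le_exp.2 (neg_le_neg (mul_le_mul_of_nonneg_left (hdist i n y y' ω hω) (half_pos hδ).le))
    _ = ((W i n y y').card : ℝ) * Real.exp (-(δ / 2 * (geo i).dist y y')) := by
        rw [Finset.sum_const, nsmul_eq_mul]
    _ ≤ N₀ * D₀ ^ n * Real.exp (-(δ / 2 * (geo i).dist y y')) :=
        mul_le_mul_of_nonneg_right (hcard i n y y') (Real.exp_nonneg _)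

variable {g : Geometry} {B : Backgrounds} {E₁ : RWExpansion g B}

/-- **d(y, y′) ≤ d(ω, y, y′)** for a walk from y to y′, from the geometry laws of `B9Thm314.LocData` (the chain of (3.93) is undercut by
`E.wdist`, and a chain is at least d(y, y′) long by the triangle inequality — `B9Thm314.chainSum_ge_ends`); at the record the laws
are `B9Thm314WholePinGeometry.locDataY_laws`. [cite: Balaban1985BackgroundPropagators, (3.93) p.410; Balaban1984PropagatorsII, (2.54) p.233] -/
theorem dist_le_wdist_of_laws (D : LocData g B E₁) {dOmega : g.Site → g.Site → ℝ} (L : D.Laws dOmega) {ω : E₁.Walk}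
    {y y' : g.Site} (hy : E₁.first ω y) (hy' : E₁.last ω y') : g.dist y y' ≤ E₁.wdist ω y y' := by
  obtain ⟨l, -, -, hsum⟩ := L.chain ω y y' hy hy'
  exact (chainSum_ge_ends L.d_triangle l y y').trans hsum

end Routes

/-! ## §5 Rows 23 and 22 of the certificate from the cancellation leaf, the geometry and the READING -/

section Rows

variable {I : Type} {c35 : ℝ} {geo : I → Geometry} {bg : I → Backgrounds} {Kdiff : ∀ i, KernelFamily (geo i) (bg i)}
  {OmK : ∀ i, (geo i).Site → Prop} {dOmega : ∀ i, (geo i).Site → (geo i).Site → ℝ}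
  {Ediff : ∀ i, RWExpansion (geo i) (bg i)} {termK : ∀ i, (Ediff i).Walk → KernelFamily (geo i) (bg i)}
  {Ps : ∀ i, (geo i).Loc → Prop}

/-- ★ **ROW 23 — THEOREM 3.14, LOCAL READING (`B9Thm314.Thm314LocalPrinted`) FROM THE CANCELLATION LEAF, THE GEOMETRY AND THE READING**:
`B9Thm314Whole.thm314LocalPrinted_of_leaves` with its two summation-with-factor leaves `hS`, `hH` SUPPLIED by §3 from the walk sets `W`,
their laws, the uniform weight summability and the domination reading of `Converges`.  Displayed, as there: the all-norms cancellation
leaf `hA` (G-B9-08), `LocData`/`Laws`, the M-uniform diameter bound `hr` (typed-leaf flag T314 (ii) STANDS), the model signs, d(·,·,Ω) ≥ 0.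
Nothing of print asserted; NOT a node discharge. [cite: Balaban1985BackgroundPropagators, Thm 3.14 (3.154) pp.426–427] -/
theorem thm314LocalPrinted_of_reading (D : ∀ i, LocData (geo i) (bg i) (Ediff i)) (L : ∀ i, (D i).Laws (dOmega i)) (r₀ : ℝ)
    (hr : ∀ i, (D i).diam ≤ r₀) (S : ∀ i, ModelSignsOn (geo i) (Ps i)) (hdΩ : ∀ (i : I) (y y' : (geo i).Site), 0 ≤ dOmega i y y')
    (hA : DiffExpansionAllNorms c35 geo bg Ediff termK (fun i => (D i).Touches))
    (W : ∀ i, ℕ → (geo i).Site → (geo i).Site → Finset (Ediff i).Walk) (hW : ∀ i, WalkSetsSpec (Ediff i) (W i))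
    (hcnt : WalkWeightsSummable geo bg Ediff W)
    (hdom : ∀ (i : I) (U : (bg i).Cfg), (Ediff i).Converges U → DominatedBySums (Ediff i) (termK i) (Kdiff i) (W i) U) :
    Thm314LocalPrinted c35 geo bg Kdiff OmK dOmega :=
  thm314LocalPrinted_of_leaves D L r₀ hr S hdΩ hA (rwSumFactorYieldsSupL2_of_reading S W hW hcnt hdom OmK)
    (rwSumFactorYieldsHolder_of_reading S W hW hcnt hdom OmK)

/-- ★ **ROW 22 — THEOREM 3.14 AS THE LEAF FIELD `B9.Thm314Printed`** (sup entries, no localisation restriction) from the same data: the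
reading supplies the unrestricted sup/L² summation leaf of `B9Thm314Whole.thm314Printed_of_leaves_allNorms`.
[cite: Balaban1985BackgroundPropagators, Thm 3.14 (3.154) pp.426–427] -/
theorem thm314Printed_of_reading (D : ∀ i, LocData (geo i) (bg i) (Ediff i)) (L : ∀ i, (D i).Laws (dOmega i)) (r₀ : ℝ)
    (hr : ∀ i, (D i).diam ≤ r₀) (S : ∀ i, ModelSignsOn (geo i) (Ps i)) (hdΩ : ∀ (i : I) (y y' : (geo i).Site), 0 ≤ dOmega i y y')
    (hA : DiffExpansionAllNorms c35 geo bg Ediff termK (fun i => (D i).Touches))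
    (W : ∀ i, ℕ → (geo i).Site → (geo i).Site → Finset (Ediff i).Walk) (hW : ∀ i, WalkSetsSpec (Ediff i) (W i))
    (hcnt : WalkWeightsSummable geo bg Ediff W)
    (hdom : ∀ (i : I) (U : (bg i).Cfg), (Ediff i).Converges U → DominatedBySums (Ediff i) (termK i) (Kdiff i) (W i) U) :
    Thm314Printed c35 geo bg Kdiff dOmega :=
  thm314Printed_of_leaves_allNorms D L r₀ hr S hdΩ hA (rwSumFactorYieldsSupL2_of_reading S W hW hcnt hdom fun _ _ => True)

/-- **Both leaf fields of the certificate at once** (`t314` and `t314loc`) from the cancellation leaf, the geometry and the reading.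
[cite: Balaban1985BackgroundPropagators, Thm 3.14 (3.154) pp.426–427] -/
theorem thm314_pair_of_reading (D : ∀ i, LocData (geo i) (bg i) (Ediff i)) (L : ∀ i, (D i).Laws (dOmega i)) (r₀ : ℝ)
    (hr : ∀ i, (D i).diam ≤ r₀) (S : ∀ i, ModelSignsOn (geo i) (Ps i)) (hdΩ : ∀ (i : I) (y y' : (geo i).Site), 0 ≤ dOmega i y y')
    (hA : DiffExpansionAllNorms c35 geo bg Ediff termK (fun i => (D i).Touches))
    (W : ∀ i, ℕ → (geo i).Site → (geo i).Site → Finset (Ediff i).Walk) (hW : ∀ i, WalkSetsSpec (Ediff i) (W i))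
    (hcnt : WalkWeightsSummable geo bg Ediff W)
    (hdom : ∀ (i : I) (U : (bg i).Cfg), (Ediff i).Converges U → DominatedBySums (Ediff i) (termK i) (Kdiff i) (W i) U) :
    Thm314Printed c35 geo bg Kdiff dOmega ∧ Thm314LocalPrinted c35 geo bg Kdiff OmK dOmega :=
  ⟨thm314Printed_of_reading D L r₀ hr S hdΩ hA W hW hcnt hdom, thm314LocalPrinted_of_reading D L r₀ hr S hdΩ hA W hW hcnt hdom⟩

end Rows

end Literature.MathematicalPhysics.QuantumFieldTheory.Balaban1983to89.B9Thm314WholeSummation
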